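import Mathlib

/-!
# Route `NodalDiracTwist` — crux `NodalDiracWeakCoupling`, line `birth`: Möbius sign, part 3 (the 2 × 2 pencil)

Helper file (`--supports stmt-HubbardSuperconductivity-10370`) for the lead's assembly stub
`stub_moebiusAbstract`. Pure algebra of the linearised real symmetric traceless `2 × 2` pencil
`[[a, β], [β, -a]]`, `ρ = √(a² + β²)`, and of its lower eigenvector encoded as a unit complex
number `E = x + iy` with `E² ρ = -(a + iβ)`:
* `pencil_re_im_of_sq`: unpacking `E² ρ = -(a + iβ)` into `(x² - y²) ρ = -a`, `2xy ρ = -β`;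
* `pencil_identity` / `pencil_lower_bound`: for coefficients `c₁, c₂ ∈ ℂ` the deviation form
  `D = ρ(|c₁|² + |c₂|²) + a(|c₁|² - |c₂|²) + 2β Re(c̄₁ c₂)` equals `2ρ |y c₁ - x c₂|²`, whence
  `|x c₁ + y c₂|² = |c₁|² + |c₂|² - D/(2ρ)` is close to `1` when the weight outside the frame and
  the deviation are small (this converts the energy estimates of `stub_coneEnergy` into closeness
  of the true ground state to the ideal eigenvector `x e₁ + y e₂`);
* `det_ne_zero_of_pencil_nondeg`: a pencil `(a(u), β(u))` linear in the direction `u` with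
  `a² + β² ≥ (m/2)² > 0` on the unit circle has `a₀ β₁ - a₁ β₀ ≠ 0`.
Sources: Herzberg–Longuet-Higgins, Discuss. Faraday Soc. 35 (1963) 77; Kato (1966) II §5.
No definitions.
-/

-- the mandated namespace `Summit.<Summit>.<Problem>.Theorems` repeats `HubbardSuperconductivity`
-- (single-problem summit, D-0017), which the `dupNamespace` linter flags on every declaration
set_option linter.dupNamespace false

namespace Summit.HubbardSuperconductivity.HubbardSuperconductivity.Theorems.NodalDiracTwist

open Complex
open scoped ComplexConjugate

/-! ### Unpacking `E² ρ = -(a + iβ)` -/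

/-- Real and imaginary parts of `E² ρ = -(a + iβ)`: `(x² - y²)ρ = -a` and `2xyρ = -β` for
`E = x + iy`. [folklore] -/
theorem pencil_re_im_of_sq {E : ℂ} {a β ρ : ℝ}
    (h : E ^ 2 * (ρ : ℂ) = -((a : ℂ) + (β : ℂ) * Complex.I)) :
    (E.re ^ 2 - E.im ^ 2) * ρ = -a ∧ 2 * E.re * E.im * ρ = -β := by
  have hre := congrArg Complex.re h
  have him := congrArg Complex.im h
  simp only [Complex.mul_re, Complex.mul_im, Complex.ofReal_re, Complex.ofReal_im, mul_zero,
    sub_zero, add_zero, Complex.neg_re, Complex.neg_im, Complex.add_re, Complex.add_im,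
    Complex.I_re, Complex.I_im, mul_one, zero_add, pow_two] at hre him
  constructor
  · nlinarith [hre]
  · nlinarith [him]

/-- A unit complex number `E = x + iy` has `x² + y² = 1`. [folklore] -/
theorem re_sq_add_im_sq_of_norm_eq_one {E : ℂ} (h : ‖E‖ = 1) : E.re ^ 2 + E.im ^ 2 = 1 := by
  have h2 : ‖E‖ ^ 2 = 1 := by rw [h, one_pow]
  rw [Complex.sq_norm, Complex.normSq_apply] at h2
  nlinarith [h2]

/-! ### The deviation form and the lower eigenvector -/

/-- **Pencil identity.** For real `x, y, a, β, ρ` with `x² + y² = 1`, `(x² - y²)ρ = -a`,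
`2xyρ = -β` and any `c₁, c₂ ∈ ℂ`:
`ρ |x c₁ + y c₂|² = ρ(|c₁|² + |c₂|²) - D/2` with
`D = ρ(|c₁|² + |c₂|²) + a(|c₁|² - |c₂|²) + 2 Re(c̄₁ c₂ β)` — i.e. `D = 2ρ |y c₁ - x c₂|²`, the
deviation form is `2ρ ×` the weight along the upper eigenvector `(-y, x)` of `[[a, β], [β, -a]]`.
[folklore] -/
theorem pencil_identity {x y a β ρ : ℝ} (hxy : x ^ 2 + y ^ 2 = 1)
    (ha : (x ^ 2 - y ^ 2) * ρ = -a) (hb : 2 * x * y * ρ = -β) (c₁ c₂ : ℂ) :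
    ρ * ‖(x : ℂ) * c₁ + (y : ℂ) * c₂‖ ^ 2 =
      ρ * (‖c₁‖ ^ 2 + ‖c₂‖ ^ 2) -
        (ρ * (‖c₁‖ ^ 2 + ‖c₂‖ ^ 2) + a * (‖c₁‖ ^ 2 - ‖c₂‖ ^ 2) +
          2 * (conj c₁ * c₂ * (β : ℂ)).re) / 2 := by
  have h1 : ‖(x : ℂ) * c₁ + (y : ℂ) * c₂‖ ^ 2 =
      (x * c₁.re + y * c₂.re) ^ 2 + (x * c₁.im + y * c₂.im) ^ 2 := by
    rw [Complex.sq_norm, Complex.normSq_apply]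
    simp only [Complex.add_re, Complex.add_im, Complex.mul_re, Complex.mul_im, Complex.ofReal_re,
      Complex.ofReal_im, zero_mul, sub_zero, add_zero]
    ring
  have h2 : ‖c₁‖ ^ 2 = c₁.re ^ 2 + c₁.im ^ 2 := by
    rw [Complex.sq_norm, Complex.normSq_apply]; ring
  have h3 : ‖c₂‖ ^ 2 = c₂.re ^ 2 + c₂.im ^ 2 := by
    rw [Complex.sq_norm, Complex.normSq_apply]; ring
  have h4 : (conj c₁ * c₂ * (β : ℂ)).re = β * (c₁.re * c₂.re + c₁.im * c₂.im) := by
    simp only [Complex.mul_re, Complex.mul_im, Complex.conj_re, Complex.conj_im, Complex.ofReal_re,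
      Complex.ofReal_im, mul_zero, sub_zero]
    ring
  rw [h1, h2, h3, h4]
  linear_combination (1 / 2 * ρ * ((c₁.re ^ 2 + c₁.im ^ 2) + (c₂.re ^ 2 + c₂.im ^ 2))) * hxy +
    (1 / 2 * ((c₁.re ^ 2 + c₁.im ^ 2) - (c₂.re ^ 2 + c₂.im ^ 2))) * ha +
    (c₁.re * c₂.re + c₁.im * c₂.im) * hb

/-- **Closeness to the ideal eigenvector.** In the situation of `pencil_identity`, if the pencil
is nondegenerate (`m/2 ≤ ρ`, `m > 0`), the weight outside the frame `1 - |c₁|² - |c₂|²` is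
`≤ η` and the deviation form is `≤ η`, then the overlap with the ideal lower eigenvector is almost
full: `1 - η - η/m ≤ |x c₁ + y c₂|²`. [folklore] -/
theorem pencil_lower_bound {x y a β ρ m η : ℝ} (hxy : x ^ 2 + y ^ 2 = 1)
    (ha : (x ^ 2 - y ^ 2) * ρ = -a) (hb : 2 * x * y * ρ = -β) (hm : 0 < m) (hρ : m / 2 ≤ ρ)
    (hη : 0 ≤ η) {c₁ c₂ : ℂ} (hout : 1 - ‖c₁‖ ^ 2 - ‖c₂‖ ^ 2 ≤ η)
    (hdev : ρ * (‖c₁‖ ^ 2 + ‖c₂‖ ^ 2) + a * (‖c₁‖ ^ 2 - ‖c₂‖ ^ 2) +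
      2 * (conj c₁ * c₂ * (β : ℂ)).re ≤ η) :
    1 - η - η / m ≤ ‖(x : ℂ) * c₁ + (y : ℂ) * c₂‖ ^ 2 := by
  have hρ0 : 0 < ρ := by linarith
  have hid := pencil_identity hxy ha hb c₁ c₂
  -- `ρ t² ≥ ρ (1 - η) - η/2`
  have h1 : ρ * (1 - η) - η / 2 ≤ ρ * ‖(x : ℂ) * c₁ + (y : ℂ) * c₂‖ ^ 2 := by
    rw [hid]
    nlinarith
  -- `η/2 ≤ ρ η / m` since `m ≤ 2ρ`
  have h2 : η / 2 ≤ ρ * (η / m) := by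
    rw [mul_div_assoc', div_le_div_iff₀ (by norm_num) hm]
    nlinarith [mul_nonneg hη (by linarith : (0 : ℝ) ≤ 2 * ρ - m)]
  have h3 : ρ * (1 - η - η / m) ≤ ρ * ‖(x : ℂ) * c₁ + (y : ℂ) * c₂‖ ^ 2 := by
    calc ρ * (1 - η - η / m) = ρ * (1 - η) - ρ * (η / m) := by ring
      _ ≤ ρ * (1 - η) - η / 2 := by linarith
      _ ≤ _ := h1
  exact le_of_mul_le_mul_left h3 hρ0

/-! ### Nondegeneracy of the linear pencil gives a nonzero determinant -/

/-- **Nondegenerate linear pencil ⇒ nonzero determinant.** If `a(u) = a₀ u₀ + a₁ u₁`,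
`β(u) = β₀ u₀ + β₁ u₁` satisfy `(m/2)² ≤ a(u)² + β(u)²` for every unit `u` and `m > 0`, then
`a₀ β₁ - a₁ β₀ ≠ 0` (otherwise some unit `u` is a common zero of the two linear forms). [folklore] -/
theorem det_ne_zero_of_pencil_nondeg {a₀ a₁ β₀ β₁ m : ℝ} (hm : 0 < m)
    (h : ∀ u : Fin 2 → ℝ, u 0 ^ 2 + u 1 ^ 2 = 1 →
      (m / 2) ^ 2 ≤ (a₀ * u 0 + a₁ * u 1) ^ 2 + (β₀ * u 0 + β₁ * u 1) ^ 2) :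
    a₀ * β₁ - a₁ * β₀ ≠ 0 := by
  intro hdet
  have hm2 : 0 < (m / 2) ^ 2 := by positivity
  -- a common unit zero `u` of the two forms
  have key : ∀ x y : ℝ, 0 < x ^ 2 + y ^ 2 → a₀ * x + a₁ * y = 0 → β₀ * x + β₁ * y = 0 →
      False := by
    intro x y hpos hax hbx
    set n := Real.sqrt (x ^ 2 + y ^ 2) with hn
    have hn0 : 0 < n := Real.sqrt_pos.2 hpos
    have hn2 : n ^ 2 = x ^ 2 + y ^ 2 := Real.sq_sqrt hpos.le
    have hu := h ![x / n, y / n] (by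
      simp only [Matrix.cons_val_zero, Matrix.cons_val_one]
      rw [div_pow, div_pow, ← add_div, ← hn2, div_self (pow_ne_zero 2 hn0.ne')])
    simp only [Matrix.cons_val_zero, Matrix.cons_val_one] at hu
    have h1 : a₀ * (x / n) + a₁ * (y / n) = 0 := by
      rw [mul_div_assoc', mul_div_assoc', ← add_div, hax, zero_div]
    have h2 : β₀ * (x / n) + β₁ * (y / n) = 0 := by
      rw [mul_div_assoc', mul_div_assoc', ← add_div, hbx, zero_div]
    rw [h1, h2] at hu
    linarith
  by_cases hA : a₀ = 0 ∧ a₁ = 0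
  · obtain ⟨rfl, rfl⟩ := hA
    by_cases hB : β₀ = 0 ∧ β₁ = 0
    · obtain ⟨rfl, rfl⟩ := hB
      exact key 1 0 (by norm_num) (by ring) (by ring)
    · -- `u ⊥ (β₀, β₁)`
      refine key (-β₁) β₀ ?_ (by ring) (by ring)
      have hne : β₀ ^ 2 + β₁ ^ 2 ≠ 0 := fun h0 => hB ⟨by nlinarith, by nlinarith⟩
      have hpos : 0 < β₀ ^ 2 + β₁ ^ 2 := lt_of_le_of_ne (by positivity) (Ne.symm hne)
      nlinarith
  · -- `u ⊥ (a₀, a₁)`; then `β(u) = det / |a| = 0`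
    refine key (-a₁) a₀ ?_ (by ring) ?_
    · have hne : a₀ ^ 2 + a₁ ^ 2 ≠ 0 := fun h0 => hA ⟨by nlinarith, by nlinarith⟩
      have hpos : 0 < a₀ ^ 2 + a₁ ^ 2 := lt_of_le_of_ne (by positivity) (Ne.symm hne)
      nlinarith
    · linear_combination hdet

end Summit.HubbardSuperconductivity.HubbardSuperconductivity.Theorems.NodalDiracTwist
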